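import Summits.QuantumFields.BalabanUV.Beta.FP.TowerDoorDefectLoc

/-!
# `BalabanUV.Beta.FP.TowerDoorDefectFamilyLoc` — road «FP», binder row D1: **THE DOOR FAMILY IS A SECOND-ORDER VERTEX FAMILY** (v10's letter `hWΔ₂` at `j = n+1`, GENERIC HALF)
# (an2 J-NOTE-21 §5 ∕ §7 (C): «`hWΔ₂` (BiLoc at `(L•y, L•y′)`): `wΦ` decays, `DefKerℤ (λℤ_(μ,y)) β` is BiLoc near `L•β.1` with a prefactor `e^{−δ|L•β.1 − L•y|}` from PART 59 — `biLoc_wsum`-class»;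
# road d1-p3 g55 OFFER-1 l.68783.)

WHAT ([folklore] `BiLoc` bookkeeping BY NAME over PART 62's `defKerZ ∕ doorZ` and PART 64's rescaled stencils; generic letters `L tabs κ₂ κΔ lam S` — NO record object; no `def`,
no `def … : Prop`, nothing cited, 0 sorry, default heartbeats).
§0 `ℓ¹` trivia (`|e_κ|₁ = 1` for `AffineAveraging.unitVec`, `|L•v|₁ = L·|v|₁`; `|x−y|₁ = |y−x|₁` is lit `ExpKernelCalculus.l1_sub_symm`).
§1 **`biLoc_defKerZ_of_loc`** — PART 64 `biLoc_defKerZ` SHARPENED FOR A LOCALISED GAUGE FUNCTION: for `|v u| ≤ K·e^{−δv·|p − u|₁}` (PART 59 `exists_abs_lamZ_le_exp`'s shape, `p = L•z`),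
(Lmix) `LocStencilFM L tabs.mixFF C δ`, (LH) `VertexFamily tabs.H L C_H δH` and ONE displayed rate `0 < ρ ≤ δv, δ, δH`:
`BiLoc (defKerZ L tabs κ₂ v β) (L•β.1) (L•β.1) (((3+1)·(K(1+e^ρ)·(wM2·C)·Zl(ρ/4)) + 2|κ₂|·K·C_H) · e^{−(ρ/2)|p − L•β.1|₁}) (ρ/4)` — bi-localised at its window AND exponentially
small in the distance from `p` to the window (gradient term: `abs_gradWeight_le_of_loc` + lit `biLoc_wsum` on PART 64's `gradTerm_eq_wsum ∕ biLoc_rescaled_M2Z`; commutator: pointwise).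
§2 **`vertexFamily₂_doorZ`** — for `|lam μ y u| ≤ K·e^{−δv·|L•y − u|₁}` and `|S ν z κ y₀| ≤ CS·e^{−δS·|y₀ − z|₁}` (lit `decay_wΦ`'s shape × `|cS|`):
`VertexFamily₂ (doorZ L tabs κ₂ κΔ lam S) L (|κΔ|·(3+1)·(2·CS·A·Zl(δS/2))) (min (ρ/4) (δS/(2L)))`, `A` = §1's constant (each window term is bi-localised at `(L•y₀, L•y₀)` with §1's
factor and the weight `e^{−δS|y₀ − y′|₁}`, re-centred to `(L•y, L•y′)` by the triangle inequality — `abs_windowTerm_le`; the window sum bounded by `Zl(δS/2)` via lit `tsum_of_norm_bounded`),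
and **`exists_vertexFamily₂_doorZ : ∃ Cw δw, 0 < δw ∧ VertexFamily₂ (doorZ …) L Cw δw`** — v10 `FP/StepRecursionFeedNestedNamedI`'s letter `hWΔ₂` at door index `n+1` once the row's
record instance (an2 PART 69 `doorRec_succ`) feeds PART 59's bound on `λℤ`, lit `decay_wΦ` on `SRec`, and the record tables' `(Lmix)(LH)`.
WHAT THIS IS NOT: not `hWΔ₂` AT THE RECORD (the row's `exact` on §2), not `hX`, not (T2); nothing of Bałaban's asserted, valued or discharged; 0 estimates beyond bookkeeping
constants; 0∕4 row-D1 binders (hW, hR, D1Tel, D1Rep); v10 NOT filed; NOT (C1), NOT (T-ID), NOT D1, NEVER «G-an2-4 closed», NOT BetaPertH, NOT continuum, NOT Clay.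
HONEST DEPENDENCY (page 1, mandatory): continuum YM on T⁴ ⇐ BetaPertH ∧ nine spine estimates (0/9 proved); BetaPertH ⇐ (D1) ∧ (D4) ∧ CAP+tail;
G-an2-4 gates asym, D1 and NE2/3/4.  HONEST FRAMING (cell contract, verbatim): «discharging `BetaPertH` makes Bałaban's UV stability UNCONDITIONAL —
a real constructive-QFT result; it is NOT the continuum limit and NOT the Clay problem.»  ABSOLUTE RULE (cell charter, verbatim): «No internally-minted
statement may enter as a cited fact. Every hypothesis is either kernel-proved in this package or a verbatim quotation of a PUBLISHED theorem with page
reference. The manuscript(s) under audit are NOT citable for their own disputed steps — they are the thing under adjudication; programme-internal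
(2001/route/tribunal) claims are never citable.»  Road «FP» OWNER, b2b-balaban-beta-d1-p3 gen 55, 2026-08-29.  No existing file touched.
-/

noncomputable section

open Finset
open scoped BigOperators
open Literature.MathematicalPhysics.QuantumFieldTheory
open Literature.MathematicalPhysics.QuantumFieldTheory.Balaban1983to89
open Literature.MathematicalPhysics.QuantumFieldTheory.Balaban1983to89.Beta
open Literature.MathematicalPhysics.QuantumFieldTheory.Balaban1983to89.B12Sec2to5 (l1 l1_nonneg)
open AffineAveraging (Site unitVec)
open OneStepResolventKernel (Fib wsum biLoc_wsum biLoc_mono)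
open ExpKernelCalculus (MKer BiLoc VertexFamily VertexFamily₂ Zl Zl_nonneg l1_sub_triangle l1_sub_symm summable_exp_shift' tsum_exp_shift')
open SecondOrderResponse (LocStencilFM)
open BalabanStepW2 (wM2)
open Summit.QuantumFields.BalabanUV.Beta.SymmetrisedStepJets (SymTables)
open Summit.QuantumFields.BalabanUV.Beta.FP.TowerDoorDefectDefs
open Summit.QuantumFields.BalabanUV.Beta.FP.TowerDoorDefectLoc (gradTerm_eq_wsum biLoc_rescaled_M2Z)

namespace Summit.QuantumFields.BalabanUV.Beta.FP.TowerDoorDefectFamilyLoc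

/-! ## §0 `ℓ¹` trivia -/

/-- [folklore] `|e_κ|₁ = 1` for `AffineAveraging.unitVec` (lit `StepJetData.l1_unitVec` is the `B6BondElimination.unitVec` twin; `|x − y|₁ = |y − x|₁` is lit `ExpKernelCalculus.l1_sub_symm`). -/
theorem l1_unitVec (κ : Fin (3 + 1)) : l1 (unitVec κ : Site (3 + 1)) = 1 := by
  unfold l1 AffineAveraging.unitVec
  simp [Pi.single_apply, apply_ite]

/-- [folklore] `|L•v|₁ = L·|v|₁`. -/
theorem l1_natCast_zsmul (L : ℕ) (v : Site (3 + 1)) : l1 (((L : ℕ) : ℤ) • v) = (L : ℝ) * l1 v := by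
  unfold l1
  rw [Finset.mul_sum]
  refine Finset.sum_congr rfl fun μ _ => ?_
  simp [abs_mul]

/-- [folklore] a gauge function concentrated at `p` at rate `δv ≥ ρ`, read one lattice step away: `|v (u + e_κ)| ≤ K·e^{ρ}·e^{−ρ|p − u|₁}`. -/
theorem abs_shift_le_of_loc {K δv ρ : ℝ} {v : Site (3 + 1) → ℝ} {p : Site (3 + 1)} (hK : 0 ≤ K)
    (hv : ∀ u, |v u| ≤ K * Real.exp (-δv * l1 (p - u))) (hρ : 0 ≤ ρ) (hρv : ρ ≤ δv) (u : Site (3 + 1)) (κ : Fin (3 + 1)) :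
    |v (u + unitVec κ)| ≤ K * Real.exp ρ * Real.exp (-ρ * l1 (p - u)) := by
  refine (hv (u + unitVec κ)).trans ?_
  rw [mul_assoc, ← Real.exp_add]
  refine mul_le_mul_of_nonneg_left (Real.exp_le_exp.mpr ?_) hK
  have t : l1 (p - u) ≤ l1 (p - (u + unitVec κ)) + 1 := by
    have h := l1_sub_triangle p (u + unitVec κ) u
    rw [show u + unitVec κ - u = (unitVec κ : Site (3 + 1)) from add_sub_cancel_left u _, l1_unitVec] at h; exact h
  have n1 := l1_nonneg (p - (u + unitVec κ))
  nlinarith [mul_le_mul_of_nonneg_left t hρ, mul_nonneg (sub_nonneg.mpr hρv) n1]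

/-- [folklore] the unshifted value under the weaker rate: `|v u| ≤ K·e^{−ρ|p − u|₁}` for `ρ ≤ δv`. -/
theorem abs_le_of_loc {K δv ρ : ℝ} {v : Site (3 + 1) → ℝ} {p : Site (3 + 1)} (hK : 0 ≤ K)
    (hv : ∀ u, |v u| ≤ K * Real.exp (-δv * l1 (p - u))) (hρv : ρ ≤ δv) (u : Site (3 + 1)) :
    |v u| ≤ K * Real.exp (-ρ * l1 (p - u)) := by
  refine (hv u).trans (mul_le_mul_of_nonneg_left (Real.exp_le_exp.mpr ?_) hK)
  nlinarith [l1_nonneg (p - u)]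

/-! ## §1 The defect kernel of a LOCALISED gauge function: bi-localised at the window, small far from the function's centre -/

variable (L : ℕ) (tabs : SymTables 3 L)

/-- [folklore] **`abs_gradWeight_le_of_loc`** — the weight of PART 64's `gradTerm_eq_wsum` for a localised gauge function: with `c := L•β.1`,
`|(v(u+e_κ) − v u)·e^{−δ|u − c|₁}| ≤ (K(1+e^ρ)·e^{−(ρ/2)|p − c|₁}) · e^{−(ρ/2)|u − c|₁}` (`ρ ≤ δv, δ`; triangle inequality `|p − c|₁ ≤ |p − u|₁ + |u − c|₁`). -/
theorem abs_gradWeight_le_of_loc {K δv δ ρ : ℝ} {v : Site (3 + 1) → ℝ} {p : Site (3 + 1)} (hK : 0 ≤ K)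
    (hv : ∀ u, |v u| ≤ K * Real.exp (-δv * l1 (p - u))) (hρ : 0 ≤ ρ) (hρv : ρ ≤ δv) (hρδ : ρ ≤ δ)
    (κ : Fin (3 + 1)) (c : Site (3 + 1)) (u : Site (3 + 1)) :
    |(v (u + unitVec κ) - v u) * Real.exp (-δ * l1 (u - c))|
      ≤ (K * (1 + Real.exp ρ) * Real.exp (-(ρ / 2) * l1 (p - c))) * Real.exp (-(ρ / 2) * l1 (u - c)) := by
  rw [abs_mul, abs_of_pos (Real.exp_pos _)]
  have h1 := abs_shift_le_of_loc hK hv hρ hρv u κ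
  have h2 := abs_le_of_loc (ρ := ρ) hK hv hρv u
  have hsum : |v (u + unitVec κ) - v u| ≤ K * (1 + Real.exp ρ) * Real.exp (-ρ * l1 (p - u)) := by
    refine (abs_sub _ _).trans ?_
    calc |v (u + unitVec κ)| + |v u|
        ≤ K * Real.exp ρ * Real.exp (-ρ * l1 (p - u)) + K * Real.exp (-ρ * l1 (p - u)) := add_le_add h1 h2
      _ = K * (1 + Real.exp ρ) * Real.exp (-ρ * l1 (p - u)) := by ring
  have hK' : 0 ≤ K * (1 + Real.exp ρ) := mul_nonneg hK (by positivity)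
  have hexp : Real.exp (-ρ * l1 (p - u)) * Real.exp (-δ * l1 (u - c))
      ≤ Real.exp (-(ρ / 2) * l1 (p - c)) * Real.exp (-(ρ / 2) * l1 (u - c)) := by
    rw [← Real.exp_add, ← Real.exp_add, Real.exp_le_exp]
    have t := l1_sub_triangle p u c
    have n1 := l1_nonneg (p - u)
    have n2 := l1_nonneg (u - c)
    nlinarith [mul_nonneg hρ n1, mul_nonneg hρ n2, mul_nonneg (sub_nonneg.mpr hρδ) n2,
      mul_nonneg hρ (show 0 ≤ l1 (p - u) + l1 (u - c) - l1 (p - c) by linarith)]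
  calc |v (u + unitVec κ) - v u| * Real.exp (-δ * l1 (u - c))
      ≤ (K * (1 + Real.exp ρ) * Real.exp (-ρ * l1 (p - u))) * Real.exp (-δ * l1 (u - c)) :=
        mul_le_mul_of_nonneg_right hsum (Real.exp_pos _).le
    _ = K * (1 + Real.exp ρ) * (Real.exp (-ρ * l1 (p - u)) * Real.exp (-δ * l1 (u - c))) := by ring
    _ ≤ K * (1 + Real.exp ρ) * (Real.exp (-(ρ / 2) * l1 (p - c)) * Real.exp (-(ρ / 2) * l1 (u - c))) :=
        mul_le_mul_of_nonneg_left hexp hK'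
    _ = _ := by ring

/-- [folklore] **`biLoc_gradTerm_of_loc`** — each direction's gradient series of the defect kernel of a localised gauge function is bi-localised at the window
`c = L•β.1` with the constant `K(1+e^ρ)·e^{−(ρ/2)|p − c|₁}·(wM2·C)·Zl(ρ/4)` at rate `ρ/4` (lit `biLoc_wsum` on PART 64's rescaled stencils, their rate weakened to `ρ/2`). -/
theorem biLoc_gradTerm_of_loc {C δ K δv ρ : ℝ} (hmix : LocStencilFM L tabs.mixFF C δ) {v : Site (3 + 1) → ℝ} {p : Site (3 + 1)} (hK : 0 ≤ K)
    (hv : ∀ u, |v u| ≤ K * Real.exp (-δv * l1 (p - u))) (hρ : 0 < ρ) (hρv : ρ ≤ δv) (hρδ : ρ ≤ δ)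
    (κ : Fin (3 + 1)) (β : Site (3 + 1) × Fin (3 + 1)) :
    BiLoc (fun x z a b => ∑' u : Site (3 + 1), (v (u + unitVec κ) - v u) * M2Z L tabs (u, κ) β x z a b)
      (((L : ℕ) : ℤ) • β.1) (((L : ℕ) : ℤ) • β.1)
      ((K * (1 + Real.exp ρ) * Real.exp (-(ρ / 2) * l1 (p - ((L : ℕ) : ℤ) • β.1))) * (|wM2 3 L 0| * C) * Zl (3 + 1) (ρ / 4)) (ρ / 4) := by
  have hC : 0 ≤ C := hmix.nonneg
  have hw := fun u => abs_gradWeight_le_of_loc (δ := δ) hK hv hρ.le hρv hρδ κ (((L : ℕ) : ℤ) • β.1) u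
  have hK' : ∀ u : Site (3 + 1), BiLoc (Real.exp (δ * l1 (u - ((L : ℕ) : ℤ) • β.1)) • M2Z L tabs (u, κ) β) u u (|wM2 3 L 0| * C) (ρ / 2) :=
    fun u => biLoc_mono (biLoc_rescaled_M2Z L tabs hmix u κ β) (by positivity) (by linarith)
  have h := biLoc_wsum hw hK' (half_pos hρ) (by positivity)
  rw [show ρ / 2 / 2 = ρ / 4 by ring] at h
  intro x z a b
  dsimp only
  rw [gradTerm_eq_wsum L tabs δ v κ β x z a b]; exact h x z a b

/-- [folklore] **`abs_commTerm_le_of_loc`** — the commutator term of the defect kernel of a localised gauge function, pointwise: with `c = L•β.1`, `H := tabs.H β.2 β.1` bi-localised at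
`(c, c)` at rate `δH ≥ ρ`, `|κ₂·(v x·H x z − H x z·v z)| ≤ 2|κ₂|·K·C_H·e^{−(ρ/2)|p − c|₁}·e^{−(ρ/2)(|x − c|₁ + |z − c|₁)}`. -/
theorem abs_commTerm_le_of_loc {C_H δH K δv ρ : ℝ} (hH : VertexFamily tabs.H L C_H δH) (κ₂ : ℝ) {v : Site (3 + 1) → ℝ} {p : Site (3 + 1)} (hK : 0 ≤ K)
    (hv : ∀ u, |v u| ≤ K * Real.exp (-δv * l1 (p - u))) (hρ : 0 ≤ ρ) (hρv : ρ ≤ δv) (hρH : ρ ≤ δH)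
    (β : Site (3 + 1) × Fin (3 + 1)) (x z : Site (3 + 1)) (a b : Fib 3) :
    |κ₂ * (v x * tabs.H β.2 β.1 x z a b - tabs.H β.2 β.1 x z a b * v z)|
      ≤ 2 * |κ₂| * K * C_H * Real.exp (-(ρ / 2) * l1 (p - ((L : ℕ) : ℤ) • β.1))
          * Real.exp (-(ρ / 2) * (l1 (x - ((L : ℕ) : ℤ) • β.1) + l1 (z - ((L : ℕ) : ℤ) • β.1))) := by
  set c : Site (3 + 1) := ((L : ℕ) : ℤ) • β.1 with hc
  have hHe := hH β.2 β.1 x z a b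
  have hCH : 0 ≤ C_H := (hH β.2 β.1).nonneg (Sum.inl 0)
  rw [← hc] at hHe
  have hx := abs_le_of_loc (ρ := ρ) hK hv hρv x
  have hz := abs_le_of_loc (ρ := ρ) hK hv hρv z
  have nX := l1_nonneg (x - c); have nZ := l1_nonneg (z - c)
  have tX := l1_sub_triangle p x c; have tZ := l1_sub_triangle p z c
  -- the Hessian table at the weaker rate `ρ`
  have hHρ : |tabs.H β.2 β.1 x z a b| ≤ C_H * Real.exp (-ρ * (l1 (x - c) + l1 (z - c))) := by
    refine hHe.trans (mul_le_mul_of_nonneg_left (Real.exp_le_exp.mpr ?_) hCH)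
    nlinarith [mul_nonneg (sub_nonneg.mpr hρH) (add_nonneg nX nZ)]
  have E1 : Real.exp (-ρ * l1 (p - x)) * Real.exp (-ρ * (l1 (x - c) + l1 (z - c)))
      ≤ Real.exp (-(ρ / 2) * l1 (p - c)) * Real.exp (-(ρ / 2) * (l1 (x - c) + l1 (z - c))) := by
    rw [← Real.exp_add, ← Real.exp_add, Real.exp_le_exp]
    nlinarith [mul_nonneg hρ (l1_nonneg (p - x)), mul_nonneg hρ nX, mul_nonneg hρ nZ,
      mul_nonneg hρ (show 0 ≤ l1 (p - x) + l1 (x - c) - l1 (p - c) by linarith)]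
  have E2 : Real.exp (-ρ * l1 (p - z)) * Real.exp (-ρ * (l1 (x - c) + l1 (z - c)))
      ≤ Real.exp (-(ρ / 2) * l1 (p - c)) * Real.exp (-(ρ / 2) * (l1 (x - c) + l1 (z - c))) := by
    rw [← Real.exp_add, ← Real.exp_add, Real.exp_le_exp]
    nlinarith [mul_nonneg hρ (l1_nonneg (p - z)), mul_nonneg hρ nX, mul_nonneg hρ nZ,
      mul_nonneg hρ (show 0 ≤ l1 (p - z) + l1 (z - c) - l1 (p - c) by linarith)]
  have P1 : |v x * tabs.H β.2 β.1 x z a b|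
      ≤ K * C_H * (Real.exp (-(ρ / 2) * l1 (p - c)) * Real.exp (-(ρ / 2) * (l1 (x - c) + l1 (z - c)))) := by
    rw [abs_mul]
    calc |v x| * |tabs.H β.2 β.1 x z a b|
        ≤ (K * Real.exp (-ρ * l1 (p - x))) * (C_H * Real.exp (-ρ * (l1 (x - c) + l1 (z - c)))) :=
          mul_le_mul hx hHρ (abs_nonneg _) ((abs_nonneg _).trans hx)
      _ = K * C_H * (Real.exp (-ρ * l1 (p - x)) * Real.exp (-ρ * (l1 (x - c) + l1 (z - c)))) := by ring
      _ ≤ _ := mul_le_mul_of_nonneg_left E1 (mul_nonneg hK hCH)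
  have P2 : |tabs.H β.2 β.1 x z a b * v z|
      ≤ K * C_H * (Real.exp (-(ρ / 2) * l1 (p - c)) * Real.exp (-(ρ / 2) * (l1 (x - c) + l1 (z - c)))) := by
    rw [abs_mul, mul_comm]
    calc |v z| * |tabs.H β.2 β.1 x z a b|
        ≤ (K * Real.exp (-ρ * l1 (p - z))) * (C_H * Real.exp (-ρ * (l1 (x - c) + l1 (z - c)))) :=
          mul_le_mul hz hHρ (abs_nonneg _) ((abs_nonneg _).trans hz)
      _ = K * C_H * (Real.exp (-ρ * l1 (p - z)) * Real.exp (-ρ * (l1 (x - c) + l1 (z - c)))) := by ring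
      _ ≤ _ := mul_le_mul_of_nonneg_left E2 (mul_nonneg hK hCH)
  rw [abs_mul]
  calc |κ₂| * |v x * tabs.H β.2 β.1 x z a b - tabs.H β.2 β.1 x z a b * v z|
      ≤ |κ₂| * (K * C_H * (Real.exp (-(ρ / 2) * l1 (p - c)) * Real.exp (-(ρ / 2) * (l1 (x - c) + l1 (z - c))))
          + K * C_H * (Real.exp (-(ρ / 2) * l1 (p - c)) * Real.exp (-(ρ / 2) * (l1 (x - c) + l1 (z - c))))) :=
        mul_le_mul_of_nonneg_left ((abs_sub _ _).trans (add_le_add P1 P2)) (abs_nonneg _)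
    _ = _ := by ring

/-- [folklore] **`biLoc_defKerZ_of_loc` — THE WARD-DEFECT KERNEL OF A LOCALISED GAUGE FUNCTION IS BI-LOCALISED AT ITS WINDOW AND SMALL FAR FROM THE FUNCTION's CENTRE**
(PART 64 `biLoc_defKerZ` sharpened): for `|v u| ≤ K·e^{−δv·|p − u|₁}`, (Lmix) `LocStencilFM L tabs.mixFF C δ`, (LH) `VertexFamily tabs.H L C_H δH` and one rate `0 < ρ ≤ δv, δ, δH`:
`BiLoc (defKerZ L tabs κ₂ v β) (L•β.1) (L•β.1) (((3+1)·(K(1+e^ρ)·(wM2·C)·Zl(ρ/4)) + 2|κ₂|·K·C_H) · e^{−(ρ/2)|p − L•β.1|₁}) (ρ/4)`. -/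
theorem biLoc_defKerZ_of_loc {C δ C_H δH K δv ρ : ℝ} (hmix : LocStencilFM L tabs.mixFF C δ) (hH : VertexFamily tabs.H L C_H δH)
    (κ₂ : ℝ) {v : Site (3 + 1) → ℝ} {p : Site (3 + 1)} (hK : 0 ≤ K) (hv : ∀ u, |v u| ≤ K * Real.exp (-δv * l1 (p - u)))
    (hρ : 0 < ρ) (hρv : ρ ≤ δv) (hρδ : ρ ≤ δ) (hρH : ρ ≤ δH) (β : Site (3 + 1) × Fin (3 + 1)) :
    BiLoc (defKerZ L tabs κ₂ v β) (((L : ℕ) : ℤ) • β.1) (((L : ℕ) : ℤ) • β.1)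
      ((((3 + 1 : ℕ) : ℝ) * (K * (1 + Real.exp ρ) * (|wM2 3 L 0| * C) * Zl (3 + 1) (ρ / 4)) + 2 * |κ₂| * K * C_H)
        * Real.exp (-(ρ / 2) * l1 (p - ((L : ℕ) : ℤ) • β.1))) (ρ / 4) := by
  have hC : 0 ≤ C := hmix.nonneg; have hCH : 0 ≤ C_H := (hH β.2 β.1).nonneg (Sum.inl 0)
  have hZ : 0 ≤ Zl (3 + 1) (ρ / 4) := Zl_nonneg (by positivity)
  set c : Site (3 + 1) := ((L : ℕ) : ℤ) • β.1 with hc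
  set F : ℝ := Real.exp (-(ρ / 2) * l1 (p - c)) with hF
  have hF0 : 0 ≤ F := (Real.exp_pos _).le
  set G : ℝ := K * (1 + Real.exp ρ) * (|wM2 3 L 0| * C) * Zl (3 + 1) (ρ / 4) with hG
  have hG0 : 0 ≤ G := by rw [hG]; positivity
  intro x z a b
  set E : ℝ := Real.exp (-(ρ / 4) * (l1 (x - c) + l1 (z - c))) with hE
  have hE0 : 0 ≤ E := (Real.exp_pos _).le
  have htot : 0 ≤ (((3 + 1 : ℕ) : ℝ) * G + 2 * |κ₂| * K * C_H) * F * E := by positivity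
  rcases a with α | m
  · rcases b with α' | m'
    · rw [defKerZ_apply_inl_inl]
      -- gradient part: four directions, each `≤ G·F·E`
      have hgrad : |∑ κ : Fin (3 + 1), ∑' u : Site (3 + 1), (v (u + unitVec κ) - v u) * M2Z L tabs (u, κ) β x z (Sum.inl α) (Sum.inl α')|
          ≤ ((3 + 1 : ℕ) : ℝ) * G * F * E := by
        refine (Finset.abs_sum_le_sum_abs _ _).trans ?_
        have hk : ∀ κ : Fin (3 + 1), |∑' u : Site (3 + 1), (v (u + unitVec κ) - v u) * M2Z L tabs (u, κ) β x z (Sum.inl α) (Sum.inl α')| ≤ G * F * E := by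
          intro κ
          have h := biLoc_gradTerm_of_loc L tabs hmix hK hv hρ hρv hρδ κ β x z (Sum.inl α) (Sum.inl α')
          refine h.trans (le_of_eq ?_)
          rw [hG, hF, hE]; ring
        refine (Finset.sum_le_sum fun κ _ => hk κ).trans ?_
        rw [Finset.sum_const, nsmul_eq_mul, Finset.card_univ, Fintype.card_fin]
        exact le_of_eq (by push_cast; ring)
      -- commutator part: `≤ 2|κ₂| K C_H · F · E` (rate `ρ/2` weakened to `ρ/4`)
      have hcomm : |κ₂ * (v x * tabs.H β.2 β.1 x z (Sum.inl α) (Sum.inl α') - tabs.H β.2 β.1 x z (Sum.inl α) (Sum.inl α') * v z)|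
          ≤ 2 * |κ₂| * K * C_H * F * E := by
        have h := abs_commTerm_le_of_loc L tabs hH κ₂ hK hv hρ.le hρv hρH β x z (Sum.inl α) (Sum.inl α')
        refine h.trans ?_
        rw [hF, hE]
        refine mul_le_mul_of_nonneg_left (Real.exp_le_exp.mpr ?_) (by positivity)
        nlinarith [l1_nonneg (x - c), l1_nonneg (z - c)]
      calc |(∑ κ : Fin (3 + 1), ∑' u : Site (3 + 1), (v (u + unitVec κ) - v u) * M2Z L tabs (u, κ) β x z (Sum.inl α) (Sum.inl α'))
              - κ₂ * (v x * tabs.H β.2 β.1 x z (Sum.inl α) (Sum.inl α') - tabs.H β.2 β.1 x z (Sum.inl α) (Sum.inl α') * v z)|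
          ≤ ((3 + 1 : ℕ) : ℝ) * G * F * E + 2 * |κ₂| * K * C_H * F * E := (abs_sub _ _).trans (add_le_add hgrad hcomm)
        _ = (((3 + 1 : ℕ) : ℝ) * G + 2 * |κ₂| * K * C_H) * F * E := by ring
    · rw [defKerZ_inr_right, abs_zero]; exact htot
  · rw [defKerZ_inr_left, abs_zero]; exact htot

/-! ## §2 The door family is a second-order vertex family at blocking `L` -/

/-- [folklore] **`abs_windowTerm_le`** — ONE WINDOW TERM RE-CENTRED: if a kernel `D` is bi-localised at `(L•y₀, L•y₀)` at rate `ρ/4` with the constant `A·e^{−(ρ/2)|L•q − L•y₀|₁}`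
(§1 with `p = L•q`) and the weight obeys `|s| ≤ CS·e^{−δS|y₀ − q′|₁}`, then for `δw := min (ρ/4) (δS/(2L))`:
`|s·D x w a b| ≤ CS·A·e^{−δw(|x − L•q|₁ + |w − L•q′|₁)}·e^{−(δS/2)|y₀ − q′|₁}` AND the mirror statement with the legs exchanged
(`|x − L•q′|₁ + |w − L•q|₁`) — the triangle inequality through `L•y₀` on both legs, `|L•y₀ − L•q′|₁ = L·|y₀ − q′|₁`. -/
theorem abs_windowTerm_le [NeZero L] {A CS ρ δS : ℝ} (hA : 0 ≤ A) (hCS : 0 ≤ CS) (hρ : 0 < ρ) (hδS : 0 < δS)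
    {D : MKer (3 + 1) (Fib 3)} {s : ℝ} {y₀ q q' : Site (3 + 1)}
    (hD : BiLoc D (((L : ℕ) : ℤ) • y₀) (((L : ℕ) : ℤ) • y₀) (A * Real.exp (-(ρ / 2) * l1 (((L : ℕ) : ℤ) • q - ((L : ℕ) : ℤ) • y₀))) (ρ / 4))
    (hs : |s| ≤ CS * Real.exp (-δS * l1 (y₀ - q'))) (x w : Site (3 + 1)) (a b : Fib 3) :
    |s * D x w a b| ≤ CS * A * Real.exp (-(min (ρ / 4) (δS / (2 * L))) * (l1 (x - ((L : ℕ) : ℤ) • q) + l1 (w - ((L : ℕ) : ℤ) • q')))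
        * Real.exp (-(δS / 2) * l1 (y₀ - q')) ∧
    |s * D x w a b| ≤ CS * A * Real.exp (-(min (ρ / 4) (δS / (2 * L))) * (l1 (x - ((L : ℕ) : ℤ) • q') + l1 (w - ((L : ℕ) : ℤ) • q)))
        * Real.exp (-(δS / 2) * l1 (y₀ - q')) := by
  have hL0 : (0 : ℝ) < (L : ℝ) := by exact_mod_cast Nat.pos_of_ne_zero (NeZero.ne L)
  have hw1 : min (ρ / 4) (δS / (2 * L)) ≤ ρ / 4 := min_le_left _ _
  have hw2 : min (ρ / 4) (δS / (2 * L)) ≤ δS / (2 * L) := min_le_right _ _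
  have hw0 : 0 ≤ min (ρ / 4) (δS / (2 * L)) := le_min (by positivity) (by positivity)
  have hwL : min (ρ / 4) (δS / (2 * L)) * (L : ℝ) ≤ δS / 2 := by
    calc min (ρ / 4) (δS / (2 * L)) * (L : ℝ) ≤ δS / (2 * L) * (L : ℝ) := mul_le_mul_of_nonneg_right hw2 hL0.le
      _ = δS / 2 := by field_simp
  have hDe := hD x w a b
  have nX₀ : 0 ≤ l1 (x - ((L : ℕ) : ℤ) • y₀) := l1_nonneg _; have nW₀ : 0 ≤ l1 (w - ((L : ℕ) : ℤ) • y₀) := l1_nonneg _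
  have nP : 0 ≤ l1 (((L : ℕ) : ℤ) • q - ((L : ℕ) : ℤ) • y₀) := l1_nonneg _; have nT : 0 ≤ l1 (y₀ - q') := l1_nonneg _
  -- `|L•y₀ − L•q′|₁ = L·|y₀ − q′|₁`, `|L•y₀ − L•q|₁ = |L•q − L•y₀|₁`
  have eLT : l1 (((L : ℕ) : ℤ) • y₀ - ((L : ℕ) : ℤ) • q') = (L : ℝ) * l1 (y₀ - q') := by rw [← smul_sub, l1_natCast_zsmul]
  have eP : l1 (((L : ℕ) : ℤ) • y₀ - ((L : ℕ) : ℤ) • q) = l1 (((L : ℕ) : ℤ) • q - ((L : ℕ) : ℤ) • y₀) := l1_sub_symm _ _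
  -- triangle inequalities through `L•y₀`
  have txq : l1 (x - ((L : ℕ) : ℤ) • q) ≤ l1 (x - ((L : ℕ) : ℤ) • y₀) + l1 (((L : ℕ) : ℤ) • q - ((L : ℕ) : ℤ) • y₀) := by
    have h := l1_sub_triangle x (((L : ℕ) : ℤ) • y₀) (((L : ℕ) : ℤ) • q); rw [eP] at h; exact h
  have twq' : l1 (w - ((L : ℕ) : ℤ) • q') ≤ l1 (w - ((L : ℕ) : ℤ) • y₀) + (L : ℝ) * l1 (y₀ - q') := by
    have h := l1_sub_triangle w (((L : ℕ) : ℤ) • y₀) (((L : ℕ) : ℤ) • q'); rw [eLT] at h; exact h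
  have twq : l1 (w - ((L : ℕ) : ℤ) • q) ≤ l1 (w - ((L : ℕ) : ℤ) • y₀) + l1 (((L : ℕ) : ℤ) • q - ((L : ℕ) : ℤ) • y₀) := by
    have h := l1_sub_triangle w (((L : ℕ) : ℤ) • y₀) (((L : ℕ) : ℤ) • q); rw [eP] at h; exact h
  have txq' : l1 (x - ((L : ℕ) : ℤ) • q') ≤ l1 (x - ((L : ℕ) : ℤ) • y₀) + (L : ℝ) * l1 (y₀ - q') := by
    have h := l1_sub_triangle x (((L : ℕ) : ℤ) • y₀) (((L : ℕ) : ℤ) • q'); rw [eLT] at h; exact h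
  -- the product bound before re-centring
  have hprod : |s * D x w a b| ≤ CS * A * Real.exp (-δS * l1 (y₀ - q') + (-(ρ / 2) * l1 (((L : ℕ) : ℤ) • q - ((L : ℕ) : ℤ) • y₀)
      + -(ρ / 4) * (l1 (x - ((L : ℕ) : ℤ) • y₀) + l1 (w - ((L : ℕ) : ℤ) • y₀)))) := by
    rw [abs_mul, Real.exp_add, Real.exp_add]
    calc |s| * |D x w a b| ≤ (CS * Real.exp (-δS * l1 (y₀ - q')))
          * (A * Real.exp (-(ρ / 2) * l1 (((L : ℕ) : ℤ) • q - ((L : ℕ) : ℤ) • y₀))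
            * Real.exp (-(ρ / 4) * (l1 (x - ((L : ℕ) : ℤ) • y₀) + l1 (w - ((L : ℕ) : ℤ) • y₀)))) :=
          mul_le_mul hs hDe (abs_nonneg _) ((abs_nonneg _).trans hs)
      _ = _ := by ring
  -- bounds on the products `δw·(distance)` (then everything is linear)
  have a1 : min (ρ / 4) (δS / (2 * L)) * l1 (x - ((L : ℕ) : ℤ) • q)
      ≤ ρ / 4 * l1 (x - ((L : ℕ) : ℤ) • y₀) + ρ / 4 * l1 (((L : ℕ) : ℤ) • q - ((L : ℕ) : ℤ) • y₀) := by
    calc min (ρ / 4) (δS / (2 * L)) * l1 (x - ((L : ℕ) : ℤ) • q)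
        ≤ min (ρ / 4) (δS / (2 * L)) * (l1 (x - ((L : ℕ) : ℤ) • y₀) + l1 (((L : ℕ) : ℤ) • q - ((L : ℕ) : ℤ) • y₀)) := mul_le_mul_of_nonneg_left txq hw0
      _ ≤ ρ / 4 * (l1 (x - ((L : ℕ) : ℤ) • y₀) + l1 (((L : ℕ) : ℤ) • q - ((L : ℕ) : ℤ) • y₀)) := mul_le_mul_of_nonneg_right hw1 (add_nonneg nX₀ nP)
      _ = _ := by ring
  have a2 : min (ρ / 4) (δS / (2 * L)) * l1 (w - ((L : ℕ) : ℤ) • q')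
      ≤ ρ / 4 * l1 (w - ((L : ℕ) : ℤ) • y₀) + δS / 2 * l1 (y₀ - q') := by
    calc min (ρ / 4) (δS / (2 * L)) * l1 (w - ((L : ℕ) : ℤ) • q')
        ≤ min (ρ / 4) (δS / (2 * L)) * (l1 (w - ((L : ℕ) : ℤ) • y₀) + (L : ℝ) * l1 (y₀ - q')) := mul_le_mul_of_nonneg_left twq' hw0
      _ = min (ρ / 4) (δS / (2 * L)) * l1 (w - ((L : ℕ) : ℤ) • y₀) + (min (ρ / 4) (δS / (2 * L)) * (L : ℝ)) * l1 (y₀ - q') := by ring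
      _ ≤ _ := add_le_add (mul_le_mul_of_nonneg_right hw1 nW₀) (mul_le_mul_of_nonneg_right hwL nT)
  have b1 : min (ρ / 4) (δS / (2 * L)) * l1 (w - ((L : ℕ) : ℤ) • q)
      ≤ ρ / 4 * l1 (w - ((L : ℕ) : ℤ) • y₀) + ρ / 4 * l1 (((L : ℕ) : ℤ) • q - ((L : ℕ) : ℤ) • y₀) := by
    calc min (ρ / 4) (δS / (2 * L)) * l1 (w - ((L : ℕ) : ℤ) • q)
        ≤ min (ρ / 4) (δS / (2 * L)) * (l1 (w - ((L : ℕ) : ℤ) • y₀) + l1 (((L : ℕ) : ℤ) • q - ((L : ℕ) : ℤ) • y₀)) := mul_le_mul_of_nonneg_left twq hw0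
      _ ≤ ρ / 4 * (l1 (w - ((L : ℕ) : ℤ) • y₀) + l1 (((L : ℕ) : ℤ) • q - ((L : ℕ) : ℤ) • y₀)) := mul_le_mul_of_nonneg_right hw1 (add_nonneg nW₀ nP)
      _ = _ := by ring
  have b2 : min (ρ / 4) (δS / (2 * L)) * l1 (x - ((L : ℕ) : ℤ) • q')
      ≤ ρ / 4 * l1 (x - ((L : ℕ) : ℤ) • y₀) + δS / 2 * l1 (y₀ - q') := by
    calc min (ρ / 4) (δS / (2 * L)) * l1 (x - ((L : ℕ) : ℤ) • q')
        ≤ min (ρ / 4) (δS / (2 * L)) * (l1 (x - ((L : ℕ) : ℤ) • y₀) + (L : ℝ) * l1 (y₀ - q')) := mul_le_mul_of_nonneg_left txq' hw0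
      _ = min (ρ / 4) (δS / (2 * L)) * l1 (x - ((L : ℕ) : ℤ) • y₀) + (min (ρ / 4) (δS / (2 * L)) * (L : ℝ)) * l1 (y₀ - q') := by ring
      _ ≤ _ := add_le_add (mul_le_mul_of_nonneg_right hw1 nX₀) (mul_le_mul_of_nonneg_right hwL nT)
  have hρP : 0 ≤ ρ * l1 (((L : ℕ) : ℤ) • q - ((L : ℕ) : ℤ) • y₀) := mul_nonneg hρ.le nP
  have key1 : -δS * l1 (y₀ - q') + (-(ρ / 2) * l1 (((L : ℕ) : ℤ) • q - ((L : ℕ) : ℤ) • y₀)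
      + -(ρ / 4) * (l1 (x - ((L : ℕ) : ℤ) • y₀) + l1 (w - ((L : ℕ) : ℤ) • y₀)))
      ≤ -(min (ρ / 4) (δS / (2 * L))) * (l1 (x - ((L : ℕ) : ℤ) • q) + l1 (w - ((L : ℕ) : ℤ) • q')) + -(δS / 2) * l1 (y₀ - q') := by
    linarith [a1, a2, hρP]
  have key2 : -δS * l1 (y₀ - q') + (-(ρ / 2) * l1 (((L : ℕ) : ℤ) • q - ((L : ℕ) : ℤ) • y₀)
      + -(ρ / 4) * (l1 (x - ((L : ℕ) : ℤ) • y₀) + l1 (w - ((L : ℕ) : ℤ) • y₀)))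
      ≤ -(min (ρ / 4) (δS / (2 * L))) * (l1 (x - ((L : ℕ) : ℤ) • q') + l1 (w - ((L : ℕ) : ℤ) • q)) + -(δS / 2) * l1 (y₀ - q') := by
    linarith [b1, b2, hρP]
  have hCA : 0 ≤ CS * A := mul_nonneg hCS hA
  constructor
  · refine hprod.trans ?_
    rw [mul_assoc (CS * A), ← Real.exp_add]; exact mul_le_mul_of_nonneg_left (Real.exp_le_exp.mpr key1) hCA
  · refine hprod.trans ?_
    rw [mul_assoc (CS * A), ← Real.exp_add]; exact mul_le_mul_of_nonneg_left (Real.exp_le_exp.mpr key2) hCA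

/-- [folklore] **`vertexFamily₂_doorZ` — THE DOOR FAMILY IS A SECOND-ORDER VERTEX FAMILY AT BLOCKING `L`** (v10's `hWΔ₂` shape at `j = n+1`, generic letters): for a gauge-function family
`|lam μ y u| ≤ K·e^{−δv·|L•y − u|₁}` (PART 59's shape), a read-out weight `|S ν z κ y₀| ≤ CS·e^{−δS·|y₀ − z|₁}` (lit `decay_wΦ`'s shape), (Lmix), (LH) and one rate `0 < ρ ≤ δv, δ, δH`:
`VertexFamily₂ (doorZ L tabs κ₂ κΔ lam S) L (|κΔ|·((3+1)·(2·(CS·A·Zl(δS/2))))) (min (ρ/4) (δS/(2L)))`, `A` = §1's constant. -/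
theorem vertexFamily₂_doorZ [NeZero L] {C δ C_H δH K δv ρ CS δS : ℝ} (hmix : LocStencilFM L tabs.mixFF C δ) (hH : VertexFamily tabs.H L C_H δH)
    (κ₂ κΔ : ℝ) {lam : Fin (3 + 1) → Site (3 + 1) → (Site (3 + 1) → ℝ)} (hK : 0 ≤ K)
    (hlam : ∀ μ y u, |lam μ y u| ≤ K * Real.exp (-δv * l1 (((L : ℕ) : ℤ) • y - u)))
    (hρ : 0 < ρ) (hρv : ρ ≤ δv) (hρδ : ρ ≤ δ) (hρH : ρ ≤ δH)
    {S : Fin (3 + 1) → Site (3 + 1) → Fin (3 + 1) → Site (3 + 1) → ℝ} (hCS : 0 ≤ CS) (hδS : 0 < δS)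
    (hS : ∀ ν z κ y₀, |S ν z κ y₀| ≤ CS * Real.exp (-δS * l1 (y₀ - z))) :
    VertexFamily₂ (doorZ L tabs κ₂ κΔ lam S) L
      ( |κΔ| * (((3 + 1 : ℕ) : ℝ) * (2 * (CS * (((3 + 1 : ℕ) : ℝ) * (K * (1 + Real.exp ρ) * (|wM2 3 L 0| * C) * Zl (3 + 1) (ρ / 4)) + 2 * |κ₂| * K * C_H)
        * Zl (3 + 1) (δS / 2)))))
      (min (ρ / 4) (δS / (2 * L))) := by
  set A : ℝ := ((3 + 1 : ℕ) : ℝ) * (K * (1 + Real.exp ρ) * (|wM2 3 L 0| * C) * Zl (3 + 1) (ρ / 4)) + 2 * |κ₂| * K * C_H with hAdef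
  have hC : 0 ≤ C := hmix.nonneg; have hCH : 0 ≤ C_H := (hH 0 0).nonneg (Sum.inl 0)
  have hZ : 0 ≤ Zl (3 + 1) (ρ / 4) := Zl_nonneg (by positivity); have hA : 0 ≤ A := by rw [hAdef]; positivity
  set δw : ℝ := min (ρ / 4) (δS / (2 * L)) with hδw
  intro μ y ν y' x w a b
  -- §1 at the two sources
  have hD : ∀ (μ' : Fin (3 + 1)) (q y₀ : Site (3 + 1)) (κ : Fin (3 + 1)),
      BiLoc (defKerZ L tabs κ₂ (lam μ' q) (y₀, κ)) (((L : ℕ) : ℤ) • y₀) (((L : ℕ) : ℤ) • y₀)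
        (A * Real.exp (-(ρ / 2) * l1 (((L : ℕ) : ℤ) • q - ((L : ℕ) : ℤ) • y₀))) (ρ / 4) :=
    fun μ' q y₀ κ => biLoc_defKerZ_of_loc L tabs hmix hH κ₂ hK (hlam μ' q) hρ hρv hρδ hρH (y₀, κ)
  -- each direction's window sum
  have hdir : ∀ κ : Fin (3 + 1),
      |∑' y₀ : Site (3 + 1), (S ν y' κ y₀ * defKerZ L tabs κ₂ (lam μ y) (y₀, κ) x w a b + S μ y κ y₀ * defKerZ L tabs κ₂ (lam ν y') (y₀, κ) x w a b)|
        ≤ 2 * (CS * A * Zl (3 + 1) (δS / 2)) * Real.exp (-δw * (l1 (x - ((L : ℕ) : ℤ) • y) + l1 (w - ((L : ℕ) : ℤ) • y'))) := by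
    intro κ
    set E : ℝ := Real.exp (-δw * (l1 (x - ((L : ℕ) : ℤ) • y) + l1 (w - ((L : ℕ) : ℤ) • y'))) with hE
    have hs1 := (summable_exp_shift' (half_pos hδS) y').mul_left (CS * A * E)
    have hs2 := (summable_exp_shift' (half_pos hδS) y).mul_left (CS * A * E)
    have hb : ‖∑' y₀ : Site (3 + 1), (S ν y' κ y₀ * defKerZ L tabs κ₂ (lam μ y) (y₀, κ) x w a b + S μ y κ y₀ * defKerZ L tabs κ₂ (lam ν y') (y₀, κ) x w a b)‖
        ≤ ∑' y₀ : Site (3 + 1), (CS * A * E * Real.exp (-(δS / 2) * l1 (y₀ - y')) + CS * A * E * Real.exp (-(δS / 2) * l1 (y₀ - y))) :=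
      tsum_of_norm_bounded (hs1.add hs2).hasSum (fun y₀ => by
      rw [Real.norm_eq_abs]
      refine (abs_add_le _ _).trans (add_le_add ?_ ?_)
      · have h := (abs_windowTerm_le L hA hCS hρ hδS (hD μ y y₀ κ) (hS ν y' κ y₀) x w a b).1
        rw [hE]; refine h.trans (le_of_eq ?_); ring
      · have h := (abs_windowTerm_le L hA hCS hρ hδS (hD ν y' y₀ κ) (hS μ y κ y₀) x w a b).2
        rw [hE]; refine h.trans (le_of_eq ?_); ring)
    rw [Real.norm_eq_abs] at hb
    refine hb.trans (le_of_eq ?_)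
    rw [hs1.tsum_add hs2, tsum_mul_left, tsum_mul_left, tsum_exp_shift', tsum_exp_shift']
    ring
  rw [doorZ_apply, abs_mul]
  calc |κΔ| * |∑ κ : Fin (3 + 1), ∑' y₀ : Site (3 + 1),
          (S ν y' κ y₀ * defKerZ L tabs κ₂ (lam μ y) (y₀, κ) x w a b + S μ y κ y₀ * defKerZ L tabs κ₂ (lam ν y') (y₀, κ) x w a b)|
      ≤ |κΔ| * ∑ κ : Fin (3 + 1), 2 * (CS * A * Zl (3 + 1) (δS / 2)) * Real.exp (-δw * (l1 (x - ((L : ℕ) : ℤ) • y) + l1 (w - ((L : ℕ) : ℤ) • y'))) :=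
        mul_le_mul_of_nonneg_left ((Finset.abs_sum_le_sum_abs _ _).trans (Finset.sum_le_sum fun κ _ => hdir κ)) (abs_nonneg _)
    _ = |κΔ| * (((3 + 1 : ℕ) : ℝ) * (2 * (CS * A * Zl (3 + 1) (δS / 2))))
          * Real.exp (-δw * (l1 (x - ((L : ℕ) : ℤ) • y) + l1 (w - ((L : ℕ) : ℤ) • y'))) := by
        rw [Finset.sum_const, nsmul_eq_mul, Finset.card_univ, Fintype.card_fin]; push_cast; ring

/-- [folklore] **`exists_vertexFamily₂_doorZ` — v10 `FP/StepRecursionFeedNestedNamedI`'s LETTER `hWΔ₂` AT DOOR INDEX `n+1`, GENERIC HALF**: under the displayed localisation of the gauge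
functions (PART 59's shape), the exponential decay of the read-out weight (lit `decay_wΦ`'s shape) and the tables' (Lmix)(LH), `∃ Cw δw, 0 < δw ∧ VertexFamily₂ (doorZ L tabs κ₂ κΔ lam S) L Cw δw`. -/
theorem exists_vertexFamily₂_doorZ [NeZero L] {C δ C_H δH K δv CS δS : ℝ} (hmix : LocStencilFM L tabs.mixFF C δ) (hδ : 0 < δ)
    (hH : VertexFamily tabs.H L C_H δH) (hδH : 0 < δH) (κ₂ κΔ : ℝ) {lam : Fin (3 + 1) → Site (3 + 1) → (Site (3 + 1) → ℝ)} (hK : 0 ≤ K) (hδv : 0 < δv)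
    (hlam : ∀ μ y u, |lam μ y u| ≤ K * Real.exp (-δv * l1 (((L : ℕ) : ℤ) • y - u)))
    {S : Fin (3 + 1) → Site (3 + 1) → Fin (3 + 1) → Site (3 + 1) → ℝ} (hCS : 0 ≤ CS) (hδS : 0 < δS)
    (hS : ∀ ν z κ y₀, |S ν z κ y₀| ≤ CS * Real.exp (-δS * l1 (y₀ - z))) :
    ∃ Cw δw : ℝ, 0 < δw ∧ VertexFamily₂ (doorZ L tabs κ₂ κΔ lam S) L Cw δw := by
  have hL0 : (0 : ℝ) < (L : ℝ) := by exact_mod_cast Nat.pos_of_ne_zero (NeZero.ne L)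
  set ρ : ℝ := min δv (min δ δH) with hρ
  have hρ0 : 0 < ρ := lt_min hδv (lt_min hδ hδH); have hρv : ρ ≤ δv := min_le_left _ _
  have hρδ : ρ ≤ δ := (min_le_right _ _).trans (min_le_left _ _); have hρH : ρ ≤ δH := (min_le_right _ _).trans (min_le_right _ _)
  exact ⟨_, _, lt_min (by positivity) (by positivity), vertexFamily₂_doorZ L tabs hmix hH κ₂ κΔ hK hlam hρ0 hρv hρδ hρH hCS hδS hS⟩

end Summit.QuantumFields.BalabanUV.Beta.FP.TowerDoorDefectFamilyLoc

end
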